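import Mathlib
import HarnessLib
import Summits.NavierStokesRegularity.NavierStokesRegularity.Theorems.PoloidalWindowDoorPoloidalWindowRigidityLrcSpatialOfJets
import Summits.NavierStokesRegularity.NavierStokesRegularity.Theorems.PoloidalWindowDoorPoloidalWindowRigidityEntireGerm
import Summits.NavierStokesRegularity.NavierStokesRegularity.Theorems.PoloidalWindowDoorPoloidalWindowRigidityTimeShearClosed

/-!
# Route `PoloidalWindowDoor`, crux `PoloidalWindowRigidity` (K2, stmt-NavierStokesRegularity-19708), line «lrc-jet» v3 —
# `stub_lrcModEntire` REDUCED TO A POINTWISE STATEMENT AT PINNED POINTS, and K2 FROM THAT STATEMENT ALONE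

Cell ns-regularity-ideate, seat ns-poloidal-K2-p3 gen 5 (stub-worker; file landed `--supports stmt-NavierStokesRegularity-19708`
as a helper).  The K2 lead's skeleton v3 (HOME/ns-poloidal-K2-p1/Lines-lrc-jet-v3.lean) has ONE registered stub
`stub_lrcModEntire` = LRC″ with spatial pins MODULO ENTIRE UNBOUNDED GERMS: its conclusion is a trichotomy on some slice
and some nonempty open set (translation germ of the vorticity ∨ rotation germ about a vertical axis ∨ the slice agrees
there with an entire real-analytic field whose norm is unbounded on `ℝ³`).  Gen 4 of this seat reduced the v2 stub
(`stub_lrcSpatial`, two disjuncts) to a POINTWISE all-orders Killing-jet statement at pinned non-degenerate points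
(`…LrcSpatialOfJets.lrcSpatial_of_pointwise_killing_jets`, p526243).  This file is the v3 form of that reduction and the
end-to-end corollary:

* `lrcModEntire_of_pointwise` — for a profile of the class, poloidal along `e₃`: if at every point `(s, y₀)` of the slab
  that is non-degenerate (`ω ≠ 0`, `∇_h v₂ ≠ 0`, `∂₂v_h ≠ 0`) and pinned (`D_y(∂₂v_b/∂_b v₂)(s,·)(y₀) ≠ 0` for some
  horizontal `b` with `∂_b v₂ ≠ 0`) EITHER every `N`-jet at `y₀` of `p₀ Dω[e₀] + p₁ Dω[e₁] + p₂ (Dω[J·] − Jω)` is killed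
  by some `p ≠ 0` OR the slice `v s` agrees near `y₀` with an entire real-analytic field unbounded on `ℝ³`, then the
  conclusion of `stub_lrcModEntire` holds for `v` (on every admissible `W`);
* `lrcSpatial_of_pointwise_mod_entire` — the same pointwise hypothesis already gives v2's `hLRC` (the entire alternative
  is absurd in the class: nsreg-p7 g8's `…EntireGerm.not_slice_eqOn_open_of_not_bddAbove`, p522991);
* `nonflatLiouville_of_pointwise_mod_entire` — **K2's conclusion `¬ IsBackwardSingularPoint v 0` from the pointwise
  hypothesis ALONE** (the stratum (TV) is closed in the tree: ns-poloidal-K2-p2 g3's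
  `…TimeShearClosed.nonflatLiouville_of_lrcSpatial`, p526100);
* `stub_lrcModEntire_of_pointwise` / `nonflatLiouville_of_pointwiseLrcModEntire` — the fully quantified forms: the
  registered v3 stub VERBATIM (resp. K2's conclusion for every poloidal profile of the class) from the fully quantified
  pointwise statement (spelled out as the hypothesis `h`; it is the TARGET the certificate / structural lanes attack,
  not a fact, and nothing here assumes it — a skeleton can write `stub_lrcModEntire := stub_lrcModEntire_of_pointwise h`).

WHAT THIS IS NOT: not a claim about Navier–Stokes regularity, not LRC″ and not `stub_lrcModEntire` — a reduction of the
registered stub to the pointwise statement at pinned points, and the one-step composition K2 ⇐ that statement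
(bears_on LADDER-NS N0 via crux K2 = stmt-19708).
-/

noncomputable section

-- the summit and its single sub-problem share the name (CONVENTIONS §1), as in every Theorems file
set_option linter.dupNamespace false

namespace Summit.NavierStokesRegularity.NavierStokesRegularity.Theorems.PoloidalWindowDoorPoloidalWindowRigidityLrcModEntireOfJets

open Set Function Filter Topology Metric
open scoped RealInnerProductSpace InnerProductSpace
open Literature.Analysis Literature.Analysis.FluidPDE
open Summit.NavierStokesRegularity.NavierStokesRegularity.Theorems.PoloidalWindowDoorPoloidalWindowRigidityKillingJetCompactness
open Summit.NavierStokesRegularity.NavierStokesRegularity.Theorems.PoloidalWindowDoorPoloidalWindowRigidityLrcSpatialOfJets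
open Summit.NavierStokesRegularity.NavierStokesRegularity.Theorems.PoloidalWindowDoorPoloidalWindowRigidityEntireGerm
open Summit.NavierStokesRegularity.NavierStokesRegularity.Theorems.PoloidalWindowDoorPoloidalWindowRigidityTimeShearClosed

section Class

variable {C : ℝ} {v : ℝ → EuclideanSpace ℝ (Fin 3) → EuclideanSpace ℝ (Fin 3)}

/-! ### The reduction of the v3 stub -/

/-- **`stub_lrcModEntire` (for this `v`) ⇐ the pointwise statement at pinned points.**  Let `v` be a profile of the
route's Type-I class, poloidal along `e₃`, and suppose (`hP`) that at every point `(s, y₀)` of the backward slab at which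
the profile is non-degenerate (`curl v(s)(y₀) ≠ 0`, `∇_h v₂ ≠ 0`, `∂₂v_h ≠ 0`) and pinned (for some horizontal `b` with
`∂_b v₂(s,y₀) ≠ 0` the spatial derivative at `y₀` of the shear slope `∂₂v_b/∂_b v₂` of the slice is nonzero) EITHER for
every order `N` some nonzero `p ∈ ℝ³` kills the `N`-jet at `y₀` of `p₀ Dω[e₀] + p₁ Dω[e₁] + p₂ (Dω[J·] − Jω)`
(`ω = curl v(s)`, `J = rotGen`) OR the slice `v s` agrees on a neighbourhood of `y₀` with an entire real-analytic field
whose norm is not bounded above on `ℝ³`.  Then on every nonempty open non-degenerate `W` of the slab whose shear slope is not a function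
of time alone on any nonempty open subset, some slice carries on a nonempty open set a translation germ of the
vorticity, or a rotation germ about a vertical axis, or agrees there with an entire real-analytic field unbounded on
`ℝ³` — verbatim the conclusion of the registered v3 stub. -/
theorem lrcModEntire_of_pointwise (hrate : HasTypeITimeDecay C v)
    (hcont : ContinuousOn (uncurry v) (Iio (0 : ℝ) ×ˢ univ))
    (hmild : ∀ s t : ℝ, s < t → t < 0 → ∀ x,
      v t x = UnboundedOperators.heatExtension (v s) (t - s) x - oseenDuhamel 1 s v v t x)
    (hdiv : ∀ t < 0, VectorCalculus.IsDivFree (v t))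
    (hpol : ∀ s < 0, ∀ y, ⟪curl (v s) y, EuclideanSpace.single 2 1⟫_ℝ = 0)
    (hP : ∀ s < (0 : ℝ), ∀ y₀ : EuclideanSpace ℝ (Fin 3), curl (v s) y₀ ≠ 0 →
      (fderiv ℝ (v s) y₀ (EuclideanSpace.single 0 1) 2 ≠ 0 ∨ fderiv ℝ (v s) y₀ (EuclideanSpace.single 1 1) 2 ≠ 0) →
      (fderiv ℝ (v s) y₀ (EuclideanSpace.single 2 1) 0 ≠ 0 ∨ fderiv ℝ (v s) y₀ (EuclideanSpace.single 2 1) 1 ≠ 0) →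
      (∃ b : Fin 3, b ≠ 2 ∧ fderiv ℝ (v s) y₀ (EuclideanSpace.single b 1) 2 ≠ 0 ∧
        fderiv ℝ (fun y => fderiv ℝ (v s) y (EuclideanSpace.single 2 1) b / fderiv ℝ (v s) y (EuclideanSpace.single b 1) 2)
          y₀ ≠ 0) →
      (∀ N : ℕ, ∃ p : Fin 3 → ℝ, p ≠ 0 ∧ ∀ n ≤ N,
          p 0 • iteratedFDeriv ℝ n (fun y => fderiv ℝ (curl (v s)) y (EuclideanSpace.single 0 1)) y₀ +
          p 1 • iteratedFDeriv ℝ n (fun y => fderiv ℝ (curl (v s)) y (EuclideanSpace.single 1 1)) y₀ +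
          p 2 • iteratedFDeriv ℝ n (fun y => fderiv ℝ (curl (v s)) y (rotGen y) - rotGen (curl (v s) y)) y₀ = 0) ∨
      (∃ w : EuclideanSpace ℝ (Fin 3) → EuclideanSpace ℝ (Fin 3), AnalyticOnNhd ℝ w univ ∧
        ¬ BddAbove (Set.range fun y => ‖w y‖) ∧
        ∃ U : Set (EuclideanSpace ℝ (Fin 3)), IsOpen U ∧ y₀ ∈ U ∧ ∀ y ∈ U, v s y = w y)) :
    ∀ W : Set (ℝ × EuclideanSpace ℝ (Fin 3)), IsOpen W → W.Nonempty → W ⊆ Iio (0 : ℝ) ×ˢ univ →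
      (∀ z ∈ W, curl (v z.1) z.2 ≠ 0 ∧
        (fderiv ℝ (v z.1) z.2 (EuclideanSpace.single 0 1) 2 ≠ 0 ∨ fderiv ℝ (v z.1) z.2 (EuclideanSpace.single 1 1) 2 ≠ 0) ∧
        (fderiv ℝ (v z.1) z.2 (EuclideanSpace.single 2 1) 0 ≠ 0 ∨ fderiv ℝ (v z.1) z.2 (EuclideanSpace.single 2 1) 1 ≠ 0)) →
      (∀ m : ℝ → ℝ, ∀ W₁ : Set (ℝ × EuclideanSpace ℝ (Fin 3)), W₁ ⊆ W → IsOpen W₁ → W₁.Nonempty →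
        ∃ z ∈ W₁, ∃ b : Fin 3, b ≠ 2 ∧
          fderiv ℝ (v z.1) z.2 (EuclideanSpace.single 2 1) b ≠ m z.1 * fderiv ℝ (v z.1) z.2 (EuclideanSpace.single b 1) 2) →
      ∃ s : ℝ, s < 0 ∧ ∃ U : Set (EuclideanSpace ℝ (Fin 3)), IsOpen U ∧ U.Nonempty ∧
        ((∃ e : EuclideanSpace ℝ (Fin 3), e ≠ 0 ∧ ∀ y ∈ U, fderiv ℝ (curl (v s)) y e = 0) ∨
         (∃ c : EuclideanSpace ℝ (Fin 3), ∀ y ∈ U,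
            rotGen (curl (v s) y) = fderiv ℝ (curl (v s)) y (rotGen (y - c))) ∨
         (∃ w : EuclideanSpace ℝ (Fin 3) → EuclideanSpace ℝ (Fin 3), AnalyticOnNhd ℝ w univ ∧
            ¬ BddAbove (Set.range fun y => ‖w y‖) ∧ ∀ y ∈ U, v s y = w y)) := by
  intro W hW hWne hWs hnd hnc
  obtain ⟨z, hz, b, hb, hbne, hpin⟩ := exists_pin_of_not_timeOnly hrate hcont hmild hdiv hpol hW hWne hWs
    (fun z hz => (hnd z hz).2.1) hnc
  have hs : z.1 < 0 := (mem_prod.1 (hWs hz)).1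
  rcases hP z.1 hs z.2 (hnd z hz).1 (hnd z hz).2.1 (hnd z hz).2.2 ⟨b, hb, hbne, hpin⟩ with hjet | ⟨w, hw, hunb, U, hU, hzU, heq⟩
  · obtain ⟨U, hU, hUne, hsym⟩ := lrc_germ_of_killing_jets hrate hcont hmild hs z.2 hjet
    rcases hsym with htr | hrot
    · exact ⟨z.1, hs, U, hU, hUne, Or.inl htr⟩
    · exact ⟨z.1, hs, U, hU, hUne, Or.inr (Or.inl hrot)⟩
  · exact ⟨z.1, hs, U, hU, ⟨z.2, hzU⟩, Or.inr (Or.inr ⟨w, hw, hunb, heq⟩)⟩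

/-- **v2's `hLRC` ⇐ the pointwise statement at pinned points.**  The entire alternative never occurs for a profile of
the class (`…EntireGerm.not_slice_eqOn_open_of_not_bddAbove`: an entire field carrying a germ of a slice obeys the
Type-I bound everywhere), so the pointwise hypothesis `hP` gives the two-disjunct conclusion `hLRC` of
`…K2OfLrcSpatial.nonflatLiouville_of_lrc_spatial` (the registered v2 stub `stub_lrcSpatial`, instantiated at `v`). -/
theorem lrcSpatial_of_pointwise_mod_entire (hrate : HasTypeITimeDecay C v)
    (hcont : ContinuousOn (uncurry v) (Iio (0 : ℝ) ×ˢ univ))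
    (hmild : ∀ s t : ℝ, s < t → t < 0 → ∀ x,
      v t x = UnboundedOperators.heatExtension (v s) (t - s) x - oseenDuhamel 1 s v v t x)
    (hdiv : ∀ t < 0, VectorCalculus.IsDivFree (v t))
    (hpol : ∀ s < 0, ∀ y, ⟪curl (v s) y, EuclideanSpace.single 2 1⟫_ℝ = 0)
    (hP : ∀ s < (0 : ℝ), ∀ y₀ : EuclideanSpace ℝ (Fin 3), curl (v s) y₀ ≠ 0 →
      (fderiv ℝ (v s) y₀ (EuclideanSpace.single 0 1) 2 ≠ 0 ∨ fderiv ℝ (v s) y₀ (EuclideanSpace.single 1 1) 2 ≠ 0) →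
      (fderiv ℝ (v s) y₀ (EuclideanSpace.single 2 1) 0 ≠ 0 ∨ fderiv ℝ (v s) y₀ (EuclideanSpace.single 2 1) 1 ≠ 0) →
      (∃ b : Fin 3, b ≠ 2 ∧ fderiv ℝ (v s) y₀ (EuclideanSpace.single b 1) 2 ≠ 0 ∧
        fderiv ℝ (fun y => fderiv ℝ (v s) y (EuclideanSpace.single 2 1) b / fderiv ℝ (v s) y (EuclideanSpace.single b 1) 2)
          y₀ ≠ 0) →
      (∀ N : ℕ, ∃ p : Fin 3 → ℝ, p ≠ 0 ∧ ∀ n ≤ N,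
          p 0 • iteratedFDeriv ℝ n (fun y => fderiv ℝ (curl (v s)) y (EuclideanSpace.single 0 1)) y₀ +
          p 1 • iteratedFDeriv ℝ n (fun y => fderiv ℝ (curl (v s)) y (EuclideanSpace.single 1 1)) y₀ +
          p 2 • iteratedFDeriv ℝ n (fun y => fderiv ℝ (curl (v s)) y (rotGen y) - rotGen (curl (v s) y)) y₀ = 0) ∨
      (∃ w : EuclideanSpace ℝ (Fin 3) → EuclideanSpace ℝ (Fin 3), AnalyticOnNhd ℝ w univ ∧
        ¬ BddAbove (Set.range fun y => ‖w y‖) ∧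
        ∃ U : Set (EuclideanSpace ℝ (Fin 3)), IsOpen U ∧ y₀ ∈ U ∧ ∀ y ∈ U, v s y = w y)) :
    ∀ W : Set (ℝ × EuclideanSpace ℝ (Fin 3)), IsOpen W → W.Nonempty → W ⊆ Iio (0 : ℝ) ×ˢ univ →
      (∀ z ∈ W, curl (v z.1) z.2 ≠ 0 ∧
        (fderiv ℝ (v z.1) z.2 (EuclideanSpace.single 0 1) 2 ≠ 0 ∨ fderiv ℝ (v z.1) z.2 (EuclideanSpace.single 1 1) 2 ≠ 0) ∧
        (fderiv ℝ (v z.1) z.2 (EuclideanSpace.single 2 1) 0 ≠ 0 ∨ fderiv ℝ (v z.1) z.2 (EuclideanSpace.single 2 1) 1 ≠ 0)) →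
      (∀ m : ℝ → ℝ, ∀ W₁ : Set (ℝ × EuclideanSpace ℝ (Fin 3)), W₁ ⊆ W → IsOpen W₁ → W₁.Nonempty →
        ∃ z ∈ W₁, ∃ b : Fin 3, b ≠ 2 ∧
          fderiv ℝ (v z.1) z.2 (EuclideanSpace.single 2 1) b ≠ m z.1 * fderiv ℝ (v z.1) z.2 (EuclideanSpace.single b 1) 2) →
      ∃ s : ℝ, s < 0 ∧ ∃ U : Set (EuclideanSpace ℝ (Fin 3)), IsOpen U ∧ U.Nonempty ∧
        ((∃ e : EuclideanSpace ℝ (Fin 3), e ≠ 0 ∧ ∀ y ∈ U, fderiv ℝ (curl (v s)) y e = 0) ∨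
         (∃ c : EuclideanSpace ℝ (Fin 3), ∀ y ∈ U,
            rotGen (curl (v s) y) = fderiv ℝ (curl (v s)) y (rotGen (y - c)))) := by
  intro W hW hWne hWs hnd hnc
  obtain ⟨s, hs, U, hU, hUne, halt⟩ := lrcModEntire_of_pointwise hrate hcont hmild hdiv hpol hP W hW hWne hWs hnd hnc
  rcases halt with htr | hrot | ⟨w, hw, hunb, heq⟩
  · exact ⟨s, hs, U, hU, hUne, Or.inl htr⟩
  · exact ⟨s, hs, U, hU, hUne, Or.inr hrot⟩
  · exact absurd heq (not_slice_eqOn_open_of_not_bddAbove hrate hcont hmild hs hw hunb hU hUne)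

/-- **K2's conclusion from the pointwise statement ALONE.**  Class + poloidal + the pointwise hypothesis `hP` ⇒
`¬ IsBackwardSingularPoint v 0` (via `lrcSpatial_of_pointwise_mod_entire` and ns-poloidal-K2-p2 g3's
`…TimeShearClosed.nonflatLiouville_of_lrcSpatial`, in which the (TV) half is a tree theorem). -/
theorem nonflatLiouville_of_pointwise_mod_entire (hrate : HasTypeITimeDecay C v)
    (hcont : ContinuousOn (uncurry v) (Iio (0 : ℝ) ×ˢ univ))
    (hmild : ∀ s t : ℝ, s < t → t < 0 → ∀ x,
      v t x = UnboundedOperators.heatExtension (v s) (t - s) x - oseenDuhamel 1 s v v t x)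
    (hdiv : ∀ t < 0, VectorCalculus.IsDivFree (v t))
    (hpol : ∀ s < 0, ∀ y, ⟪curl (v s) y, EuclideanSpace.single 2 1⟫_ℝ = 0)
    (hP : ∀ s < (0 : ℝ), ∀ y₀ : EuclideanSpace ℝ (Fin 3), curl (v s) y₀ ≠ 0 →
      (fderiv ℝ (v s) y₀ (EuclideanSpace.single 0 1) 2 ≠ 0 ∨ fderiv ℝ (v s) y₀ (EuclideanSpace.single 1 1) 2 ≠ 0) →
      (fderiv ℝ (v s) y₀ (EuclideanSpace.single 2 1) 0 ≠ 0 ∨ fderiv ℝ (v s) y₀ (EuclideanSpace.single 2 1) 1 ≠ 0) →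
      (∃ b : Fin 3, b ≠ 2 ∧ fderiv ℝ (v s) y₀ (EuclideanSpace.single b 1) 2 ≠ 0 ∧
        fderiv ℝ (fun y => fderiv ℝ (v s) y (EuclideanSpace.single 2 1) b / fderiv ℝ (v s) y (EuclideanSpace.single b 1) 2)
          y₀ ≠ 0) →
      (∀ N : ℕ, ∃ p : Fin 3 → ℝ, p ≠ 0 ∧ ∀ n ≤ N,
          p 0 • iteratedFDeriv ℝ n (fun y => fderiv ℝ (curl (v s)) y (EuclideanSpace.single 0 1)) y₀ +
          p 1 • iteratedFDeriv ℝ n (fun y => fderiv ℝ (curl (v s)) y (EuclideanSpace.single 1 1)) y₀ +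
          p 2 • iteratedFDeriv ℝ n (fun y => fderiv ℝ (curl (v s)) y (rotGen y) - rotGen (curl (v s) y)) y₀ = 0) ∨
      (∃ w : EuclideanSpace ℝ (Fin 3) → EuclideanSpace ℝ (Fin 3), AnalyticOnNhd ℝ w univ ∧
        ¬ BddAbove (Set.range fun y => ‖w y‖) ∧
        ∃ U : Set (EuclideanSpace ℝ (Fin 3)), IsOpen U ∧ y₀ ∈ U ∧ ∀ y ∈ U, v s y = w y)) :
    ¬ IsBackwardSingularPoint v 0 :=
  nonflatLiouville_of_lrcSpatial hrate hcont hmild hdiv hpol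
    (lrcSpatial_of_pointwise_mod_entire hrate hcont hmild hdiv hpol hP)

end Class

/-! ### Fully quantified forms (skeleton-ready) -/

/-- **The registered v3 stub `stub_lrcModEntire`, VERBATIM, from the fully quantified pointwise statement.**  A skeleton
may write `theorem stub_lrcModEntire : … := stub_lrcModEntire_of_pointwise h` once the fully quantified pointwise
statement `h` is a tree theorem. -/
theorem stub_lrcModEntire_of_pointwise (h : ∀ (C : ℝ) (v : ℝ → EuclideanSpace ℝ (Fin 3) → EuclideanSpace ℝ (Fin 3)),
      Literature.Analysis.FluidPDE.HasTypeITimeDecay C v →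
      ContinuousOn (Function.uncurry v) (Set.Iio (0 : ℝ) ×ˢ Set.univ) →
      (∀ s t : ℝ, s < t → t < 0 → ∀ x, v t x =
        Literature.Analysis.UnboundedOperators.heatExtension (v s) (t - s) x -
          Literature.Analysis.FluidPDE.oseenDuhamel 1 s v v t x) →
      (∀ t < 0, Literature.Analysis.FluidPDE.VectorCalculus.IsDivFree (v t)) →
      (∀ s < 0, ∀ y, ⟪Literature.Analysis.FluidPDE.curl (v s) y, EuclideanSpace.single 2 1⟫_ℝ = 0) →
      ∀ s < (0 : ℝ), ∀ y₀ : EuclideanSpace ℝ (Fin 3), Literature.Analysis.FluidPDE.curl (v s) y₀ ≠ 0 →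
        (fderiv ℝ (v s) y₀ (EuclideanSpace.single 0 1) 2 ≠ 0 ∨ fderiv ℝ (v s) y₀ (EuclideanSpace.single 1 1) 2 ≠ 0) →
        (fderiv ℝ (v s) y₀ (EuclideanSpace.single 2 1) 0 ≠ 0 ∨ fderiv ℝ (v s) y₀ (EuclideanSpace.single 2 1) 1 ≠ 0) →
        (∃ b : Fin 3, b ≠ 2 ∧ fderiv ℝ (v s) y₀ (EuclideanSpace.single b 1) 2 ≠ 0 ∧
          fderiv ℝ (fun y => fderiv ℝ (v s) y (EuclideanSpace.single 2 1) b /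
            fderiv ℝ (v s) y (EuclideanSpace.single b 1) 2) y₀ ≠ 0) →
        (∀ N : ℕ, ∃ p : Fin 3 → ℝ, p ≠ 0 ∧ ∀ n ≤ N,
            p 0 • iteratedFDeriv ℝ n (fun y => fderiv ℝ (Literature.Analysis.FluidPDE.curl (v s)) y
              (EuclideanSpace.single 0 1)) y₀ +
            p 1 • iteratedFDeriv ℝ n (fun y => fderiv ℝ (Literature.Analysis.FluidPDE.curl (v s)) y
              (EuclideanSpace.single 1 1)) y₀ +
            p 2 • iteratedFDeriv ℝ n (fun y => fderiv ℝ (Literature.Analysis.FluidPDE.curl (v s)) y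
              (Literature.Analysis.FluidPDE.rotGen y) -
                Literature.Analysis.FluidPDE.rotGen (Literature.Analysis.FluidPDE.curl (v s) y)) y₀ = 0) ∨
        (∃ w : EuclideanSpace ℝ (Fin 3) → EuclideanSpace ℝ (Fin 3), AnalyticOnNhd ℝ w Set.univ ∧
          ¬ BddAbove (Set.range fun y => ‖w y‖) ∧
          ∃ U : Set (EuclideanSpace ℝ (Fin 3)), IsOpen U ∧ y₀ ∈ U ∧ ∀ y ∈ U, v s y = w y)) :
    ∀ (C : ℝ) (v : ℝ → EuclideanSpace ℝ (Fin 3) → EuclideanSpace ℝ (Fin 3)),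
      Literature.Analysis.FluidPDE.HasTypeITimeDecay C v →
      ContinuousOn (Function.uncurry v) (Set.Iio (0 : ℝ) ×ˢ Set.univ) →
      (∀ s t : ℝ, s < t → t < 0 → ∀ x, v t x =
        Literature.Analysis.UnboundedOperators.heatExtension (v s) (t - s) x -
          Literature.Analysis.FluidPDE.oseenDuhamel 1 s v v t x) →
      (∀ t < 0, Literature.Analysis.FluidPDE.VectorCalculus.IsDivFree (v t)) →
      (∀ s < 0, ∀ y, ⟪Literature.Analysis.FluidPDE.curl (v s) y, EuclideanSpace.single 2 1⟫_ℝ = 0) →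
      ∀ W : Set (ℝ × EuclideanSpace ℝ (Fin 3)), IsOpen W → W.Nonempty → W ⊆ Set.Iio (0 : ℝ) ×ˢ Set.univ →
        (∀ z ∈ W, Literature.Analysis.FluidPDE.curl (v z.1) z.2 ≠ 0 ∧
          (fderiv ℝ (v z.1) z.2 (EuclideanSpace.single 0 1) 2 ≠ 0 ∨ fderiv ℝ (v z.1) z.2 (EuclideanSpace.single 1 1) 2 ≠ 0) ∧
          (fderiv ℝ (v z.1) z.2 (EuclideanSpace.single 2 1) 0 ≠ 0 ∨ fderiv ℝ (v z.1) z.2 (EuclideanSpace.single 2 1) 1 ≠ 0)) →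
        (∀ m : ℝ → ℝ, ∀ W₁ : Set (ℝ × EuclideanSpace ℝ (Fin 3)), W₁ ⊆ W → IsOpen W₁ → W₁.Nonempty →
          ∃ z ∈ W₁, ∃ b : Fin 3, b ≠ 2 ∧
            fderiv ℝ (v z.1) z.2 (EuclideanSpace.single 2 1) b ≠
              m z.1 * fderiv ℝ (v z.1) z.2 (EuclideanSpace.single b 1) 2) →
        ∃ s : ℝ, s < 0 ∧ ∃ U : Set (EuclideanSpace ℝ (Fin 3)), IsOpen U ∧ U.Nonempty ∧
          ((∃ e : EuclideanSpace ℝ (Fin 3), e ≠ 0 ∧ ∀ y ∈ U, fderiv ℝ (Literature.Analysis.FluidPDE.curl (v s)) y e = 0) ∨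
           (∃ c : EuclideanSpace ℝ (Fin 3), ∀ y ∈ U,
              Literature.Analysis.FluidPDE.rotGen (Literature.Analysis.FluidPDE.curl (v s) y) =
                fderiv ℝ (Literature.Analysis.FluidPDE.curl (v s)) y (Literature.Analysis.FluidPDE.rotGen (y - c))) ∨
           (∃ w : EuclideanSpace ℝ (Fin 3) → EuclideanSpace ℝ (Fin 3), AnalyticOnNhd ℝ w Set.univ ∧
              ¬ BddAbove (Set.range fun y => ‖w y‖) ∧ ∀ y ∈ U, v s y = w y)) :=
  fun C v hrate hcont hmild hdiv hpol =>
    lrcModEntire_of_pointwise hrate hcont hmild hdiv hpol (h C v hrate hcont hmild hdiv hpol)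

/-- **K2's conclusion for every poloidal profile of the class, from the fully quantified pointwise statement** — the
composition the crux needs, in one line (the pointwise statement ⇒ K2's conclusion for poloidal profiles; the crux itself
then follows by the tree's `…Sharper` reduction exactly as in the skeleton's `PoloidalWindowRigidity_of_lrcJet`). -/
theorem nonflatLiouville_of_pointwiseLrcModEntire (h : ∀ (C : ℝ) (v : ℝ → EuclideanSpace ℝ (Fin 3) → EuclideanSpace ℝ (Fin 3)),
      Literature.Analysis.FluidPDE.HasTypeITimeDecay C v →
      ContinuousOn (Function.uncurry v) (Set.Iio (0 : ℝ) ×ˢ Set.univ) →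
      (∀ s t : ℝ, s < t → t < 0 → ∀ x, v t x =
        Literature.Analysis.UnboundedOperators.heatExtension (v s) (t - s) x -
          Literature.Analysis.FluidPDE.oseenDuhamel 1 s v v t x) →
      (∀ t < 0, Literature.Analysis.FluidPDE.VectorCalculus.IsDivFree (v t)) →
      (∀ s < 0, ∀ y, ⟪Literature.Analysis.FluidPDE.curl (v s) y, EuclideanSpace.single 2 1⟫_ℝ = 0) →
      ∀ s < (0 : ℝ), ∀ y₀ : EuclideanSpace ℝ (Fin 3), Literature.Analysis.FluidPDE.curl (v s) y₀ ≠ 0 →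
        (fderiv ℝ (v s) y₀ (EuclideanSpace.single 0 1) 2 ≠ 0 ∨ fderiv ℝ (v s) y₀ (EuclideanSpace.single 1 1) 2 ≠ 0) →
        (fderiv ℝ (v s) y₀ (EuclideanSpace.single 2 1) 0 ≠ 0 ∨ fderiv ℝ (v s) y₀ (EuclideanSpace.single 2 1) 1 ≠ 0) →
        (∃ b : Fin 3, b ≠ 2 ∧ fderiv ℝ (v s) y₀ (EuclideanSpace.single b 1) 2 ≠ 0 ∧
          fderiv ℝ (fun y => fderiv ℝ (v s) y (EuclideanSpace.single 2 1) b /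
            fderiv ℝ (v s) y (EuclideanSpace.single b 1) 2) y₀ ≠ 0) →
        (∀ N : ℕ, ∃ p : Fin 3 → ℝ, p ≠ 0 ∧ ∀ n ≤ N,
            p 0 • iteratedFDeriv ℝ n (fun y => fderiv ℝ (Literature.Analysis.FluidPDE.curl (v s)) y
              (EuclideanSpace.single 0 1)) y₀ +
            p 1 • iteratedFDeriv ℝ n (fun y => fderiv ℝ (Literature.Analysis.FluidPDE.curl (v s)) y
              (EuclideanSpace.single 1 1)) y₀ +
            p 2 • iteratedFDeriv ℝ n (fun y => fderiv ℝ (Literature.Analysis.FluidPDE.curl (v s)) y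
              (Literature.Analysis.FluidPDE.rotGen y) -
                Literature.Analysis.FluidPDE.rotGen (Literature.Analysis.FluidPDE.curl (v s) y)) y₀ = 0) ∨
        (∃ w : EuclideanSpace ℝ (Fin 3) → EuclideanSpace ℝ (Fin 3), AnalyticOnNhd ℝ w Set.univ ∧
          ¬ BddAbove (Set.range fun y => ‖w y‖) ∧
          ∃ U : Set (EuclideanSpace ℝ (Fin 3)), IsOpen U ∧ y₀ ∈ U ∧ ∀ y ∈ U, v s y = w y)) :
    ∀ (C : ℝ) (v : ℝ → EuclideanSpace ℝ (Fin 3) → EuclideanSpace ℝ (Fin 3)),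
      Literature.Analysis.FluidPDE.HasTypeITimeDecay C v →
      ContinuousOn (Function.uncurry v) (Set.Iio (0 : ℝ) ×ˢ Set.univ) →
      (∀ s t : ℝ, s < t → t < 0 → ∀ x, v t x =
        Literature.Analysis.UnboundedOperators.heatExtension (v s) (t - s) x -
          Literature.Analysis.FluidPDE.oseenDuhamel 1 s v v t x) →
      (∀ t < 0, Literature.Analysis.FluidPDE.VectorCalculus.IsDivFree (v t)) →
      (∀ s < 0, ∀ y, ⟪Literature.Analysis.FluidPDE.curl (v s) y, EuclideanSpace.single 2 1⟫_ℝ = 0) →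
      ¬ Literature.Analysis.FluidPDE.IsBackwardSingularPoint v 0 :=
  fun C v hrate hcont hmild hdiv hpol =>
    nonflatLiouville_of_pointwise_mod_entire hrate hcont hmild hdiv hpol (h C v hrate hcont hmild hdiv hpol)

end Summit.NavierStokesRegularity.NavierStokesRegularity.Theorems.PoloidalWindowDoorPoloidalWindowRigidityLrcModEntireOfJets

end
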